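import Summits.NavierStokesRegularity.NavierStokesRegularity.Theorems.AdiabaticEddyChiralEddyExistsDensity

/-!
# The field `N = ∇P × U` of Gavrilov's ansatz and its curl (support of `ChiralEddyExists`)

Helper file for item `stmt-NavierStokesRegularity-10397` (`ChiralEddyExists`, route AdiabaticEddy;
lands `--supports`).  Continuing `AdiabaticEddyChiralEddyExistsDensity`, for Gavrilov's ansatz
`U` with pressure `P = 4a` we compute in Cartesian coordinates

* `∇P = 4(a_ρ e_ρ + a_z e_z)` (`gradient_P_eq`) and the components of `N := ∇P × U`
  (`cross_gradP_U_apply_zero/one/two`),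
* the curl of `N` in Cartesian coordinates together with its differentiability (`curl_N`):
  `curl N = ρ⁻²(4X₁ M − K_z X₀, −K_z X₁ − 4X₀ M, ρ K_ρ)` with `M = c Δ*a + c_ρ a_ρ + c_z a_z`,
  `K_z = 8(a_ρ a_ρz + a_z a_zz)`, `K_ρ = 8(a_ρ a_ρρ + a_z a_ρz)`.

The combination `J = 2⟪N, ∇P × curl U⟫ + ⟪N, curl N⟫` and its positivity for Gavrilov's solution
follow in `AdiabaticEddyChiralEddyExistsDensityJ`.
-/

noncomputable section

set_option linter.dupNamespace false -- nested layout Summit.<S>.<Sub>, Sub = S (D-0017)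

open Set Filter Function WithLp InnerProductSpace
open scoped Topology RealInnerProductSpace

namespace Summit.NavierStokesRegularity.NavierStokesRegularity.Theorems.ChiralEddyExists

open Literature.Analysis.FluidPDE Literature.Analysis.FluidPDE.Gavrilov
  Literature.Analysis.FluidPDE.Gavrilov.AnsatzData

variable {A : AnsatzData} {X : EuclideanSpace ℝ (Fin 3)}

/-! ### The field `N = ∇P × U` and the quantity `J = 2⟪N, ∇P × curl U⟫ + ⟪N, curl N⟫` -/

section Nfield

variable (hX : X ∈ A.tube)
include hX

/-- The pressure gradient of the ansatz: `∇P = 4(a_ρ e_ρ + a_z e_z)`. -/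
theorem gradient_P_eq :
    gradient A.P X = toLp 2 ![4 * A.lax X * (cylRadius X)⁻¹ * X 0,
      4 * A.lax X * (cylRadius X)⁻¹ * X 1, 4 * A.lay X] := by
  ext i
  rw [gradient_apply, (hasFDerivAt_P hX).fderiv]
  fin_cases i <;>
  simp [innerSL_apply_apply, inner_eR_left, lax, lay] <;> ring

/-- `N₀ = −4((a_ρ² + a_z²) X₁ + a_z c X₀)/ρ²` for `N = ∇P × U`. -/
theorem cross_gradP_U_apply_zero : cross (gradient A.P X) (A.U X) 0 =
    -(4 * ((A.lax X ^ 2 + A.lay X ^ 2) * X 1 + A.lay X * A.lc X * X 0) * (X 0 ^ 2 + X 1 ^ 2)⁻¹) := by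
  rw [gradient_P_eq hX]
  have hr := cylRadius_ne_zero hX
  have hS := sumSq_ne_zero hX
  have hr2 := cylRadius_sq X
  simp [cross, cross_apply]
  field_simp
  linear_combination (A.lax X ^ 2 * X 1) * hr2

/-- `N₁ = 4((a_ρ² + a_z²) X₀ − a_z c X₁)/ρ²` for `N = ∇P × U`. -/
theorem cross_gradP_U_apply_one : cross (gradient A.P X) (A.U X) 1 =
    4 * ((A.lax X ^ 2 + A.lay X ^ 2) * X 0 - A.lay X * A.lc X * X 1) * (X 0 ^ 2 + X 1 ^ 2)⁻¹ := by
  rw [gradient_P_eq hX]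
  have hr := cylRadius_ne_zero hX
  have hS := sumSq_ne_zero hX
  have hr2 := cylRadius_sq X
  simp [cross, cross_apply]
  field_simp
  linear_combination (-(A.lax X ^ 2 * X 0)) * hr2

/-- `N₂ = 4 a_ρ c/ρ` for `N = ∇P × U`. -/
theorem cross_gradP_U_apply_two : cross (gradient A.P X) (A.U X) 2 =
    4 * A.lax X * A.lc X * (cylRadius X)⁻¹ := by
  rw [gradient_P_eq hX]
  have hr := cylRadius_ne_zero hX
  have hS := sumSq_ne_zero hX
  have hr2 := cylRadius_sq X
  simp [cross, cross_apply]
  field_simp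
  ring

end Nfield

section curlN

variable (hX : X ∈ A.tube)
include hX

/-- **The curl of `N = ∇P × U`** on the tube (differentiability and the three components):
with `M = c Δ*a + c_ρ a_ρ + c_z a_z`, `K_z = 8(a_ρ a_ρz + a_z a_zz)`, `K_ρ = 8(a_ρ a_ρρ + a_z a_ρz)`,
`curl N = ρ⁻²(4X₁ M − K_z X₀, −K_z X₁ − 4X₀ M, ρ K_ρ)`. -/
theorem curl_N :
    DifferentiableAt ℝ (fun Y => cross (gradient A.P Y) (A.U Y)) X ∧
    curl (fun Y => cross (gradient A.P Y) (A.U Y)) X 0 = (cylRadius X)⁻¹ ^ 2 *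
      (4 * X 1 * (A.lc X * (A.axx (meridian X) + A.ayy (meridian X) - A.ax (meridian X) * (cylRadius X)⁻¹)
          + A.cx (meridian X) * A.lax X + A.cy (meridian X) * A.lay X)
        - 8 * (A.lax X * A.axy (meridian X) + A.lay X * A.ayy (meridian X)) * X 0) ∧
    curl (fun Y => cross (gradient A.P Y) (A.U Y)) X 1 = (cylRadius X)⁻¹ ^ 2 *
      (-(8 * (A.lax X * A.axy (meridian X) + A.lay X * A.ayy (meridian X)) * X 1)
        - 4 * X 0 * (A.lc X * (A.axx (meridian X) + A.ayy (meridian X) - A.ax (meridian X) * (cylRadius X)⁻¹)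
          + A.cx (meridian X) * A.lax X + A.cy (meridian X) * A.lay X)) ∧
    curl (fun Y => cross (gradient A.P Y) (A.U Y)) X 2 =
      8 * (A.lax X * A.axx (meridian X) + A.lay X * A.axy (meridian X)) * (cylRadius X)⁻¹ := by
  have hr := cylRadius_ne_zero hX
  have hS := sumSq_ne_zero hX
  have hr2 := cylRadius_sq X
  have h3 : cylRadius X ^ 3 = (X 0 ^ 2 + X 1 ^ 2) * cylRadius X := by rw [← hr2]; ring
  have hlax := hasFDerivAt_lax hX
  have hlay := hasFDerivAt_lay hX
  have hlc := hasFDerivAt_lc hX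
  have h0c := hasFDerivAt_coord 0 X
  have h1c := hasFDerivAt_coord 1 X
  have hSi := hasFDerivAt_sumSq_inv hS
  have hri := hasFDerivAt_cylRadius_inv hr
  -- the explicit component functions and their derivatives
  have d0 := ((((((hlax.pow 2).add (hlay.pow 2)).mul h1c).add ((hlay.mul hlc).mul h0c)).mul hSi).const_mul
    4).neg
  have d1 := (((((hlax.pow 2).add (hlay.pow 2)).mul h0c).sub ((hlay.mul hlc).mul h1c)).mul hSi).const_mul 4
  have d2 := ((hlax.mul hlc).mul hri).const_mul 4
  have D0 := d0.congr_of_eventuallyEq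
      (f₁ := fun Y : EuclideanSpace ℝ (Fin 3) => (cross (gradient A.P Y) (A.U Y) 0 : ℝ)) <| by
    filter_upwards [isOpen_tube.mem_nhds hX] with Y hY
    simp only [Pi.neg_apply, Pi.mul_apply, Pi.add_apply, cross_gradP_U_apply_zero hY]
    ring
  have D1 := d1.congr_of_eventuallyEq
      (f₁ := fun Y : EuclideanSpace ℝ (Fin 3) => (cross (gradient A.P Y) (A.U Y) 1 : ℝ)) <| by
    filter_upwards [isOpen_tube.mem_nhds hX] with Y hY
    simp only [Pi.mul_apply, Pi.add_apply, Pi.sub_apply, cross_gradP_U_apply_one hY]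
    ring
  have D2 := d2.congr_of_eventuallyEq
      (f₁ := fun Y : EuclideanSpace ℝ (Fin 3) => (cross (gradient A.P Y) (A.U Y) 2 : ℝ)) <| by
    filter_upwards [isOpen_tube.mem_nhds hX] with Y hY
    simp only [Pi.mul_apply, cross_gradP_U_apply_two hY]
    ring
  have hdiff : DifferentiableAt ℝ (fun Y => cross (gradient A.P Y) (A.U Y)) X := by
    rw [differentiableAt_euclidean]
    intro i
    fin_cases i
    · exact D0.differentiableAt
    · exact D1.differentiableAt
    · exact D2.differentiableAt
  refine ⟨hdiff, ?_, ?_, ?_⟩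
  · have hc : curl (fun Y => cross (gradient A.P Y) (A.U Y)) X 0 =
        fderiv ℝ (fun Y => cross (gradient A.P Y) (A.U Y)) X (EuclideanSpace.single 1 1) 2 -
        fderiv ℝ (fun Y => cross (gradient A.P Y) (A.U Y)) X (EuclideanSpace.single 2 1) 1 := by
      simp [curl]
    rw [hc, fderiv_apply_comp hdiff, fderiv_apply_comp hdiff, D2.fderiv, D1.fderiv]
    simp only [_root_.smul_apply, _root_.add_apply, _root_.sub_apply,
      smul_eq_mul, nsmul_eq_mul, innerSL_apply_apply, inner_eR_left, PiLp.proj_apply, PiLp.single_apply,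
      Pi.mul_apply, Pi.add_apply, Pi.sub_apply, lay, lax, lc, meridian_apply]
    simp
    field_simp
    ring_nf
    simp only [h3]
    ring
  · have hc : curl (fun Y => cross (gradient A.P Y) (A.U Y)) X 1 =
        fderiv ℝ (fun Y => cross (gradient A.P Y) (A.U Y)) X (EuclideanSpace.single 2 1) 0 -
        fderiv ℝ (fun Y => cross (gradient A.P Y) (A.U Y)) X (EuclideanSpace.single 0 1) 2 := by
      simp [curl]
    rw [hc, fderiv_apply_comp hdiff, fderiv_apply_comp hdiff, D0.fderiv, D2.fderiv]
    simp only [_root_.smul_apply, _root_.add_apply, _root_.neg_apply,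
      smul_eq_mul, nsmul_eq_mul, innerSL_apply_apply, inner_eR_left, PiLp.proj_apply, PiLp.single_apply,
      Pi.mul_apply, Pi.add_apply, lay, lax, lc, meridian_apply]
    simp
    field_simp
    ring_nf
    simp only [h3]
    ring
  · have hc : curl (fun Y => cross (gradient A.P Y) (A.U Y)) X 2 =
        fderiv ℝ (fun Y => cross (gradient A.P Y) (A.U Y)) X (EuclideanSpace.single 0 1) 1 -
        fderiv ℝ (fun Y => cross (gradient A.P Y) (A.U Y)) X (EuclideanSpace.single 1 1) 0 := by
      simp [curl]
    rw [hc, fderiv_apply_comp hdiff, fderiv_apply_comp hdiff, D1.fderiv, D0.fderiv]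
    simp only [_root_.smul_apply, _root_.add_apply, _root_.sub_apply, _root_.neg_apply,
      smul_eq_mul, nsmul_eq_mul, innerSL_apply_apply, inner_eR_left, PiLp.proj_apply, PiLp.single_apply,
      Pi.mul_apply, Pi.add_apply, Pi.sub_apply, lay, lax, lc, meridian_apply]
    simp
    field_simp
    ring

end curlN


end Summit.NavierStokesRegularity.NavierStokesRegularity.Theorems.ChiralEddyExists
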